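import Mathlib
import HarnessLib

/-!
# Stub `stub_bookkeeping` — crux `TorsionLogs.NeronTorsionSector`, line `registered` (block U1)

The integer elimination of the translation chain, abstracted to an additive commutative group
`V` (the quotient `FormalRep ⧸ relations`), an additive commutative group `K` (real algebraic
constants) and an additive map `Lc : K →+ V` (constant ↦ class of the Haar-length representation
with that constant density).  From the move-derived recursions
`t (j+1) = t j + Lc (qq (j+1)) − θ j` (`j < n`, loop `t n = t 0`),
`c (j+1) = c j + Lc (qq (j+1) − qq j)`, the reflection `c 0 = t 0 + t (n−1)`, the cumulative logs
`θ j = θ 0 + Λ j` and the vanishing of the period coefficient, the target combination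
`−q²(Σ_{j∈[aa,m)} t j + Σ (j−aa)•c j) + 2p²m Σ_{j<m} c j` equals an explicit `ℤ`-combination of
the `Λ`'s.  Pure algebra: closed forms for `t j`, `c j` by induction, Gauss sums over
`[aa, m)`, three scalar identities in `ℤ` (multiplied through by `2` and cancelled), and one
`linear_combination (norm := module)`.

References: M. Kontsevich, D. Zagier, *Periods* (2001), §1.2.
-/

-- `Summit.KontsevichZagierPeriods.KontsevichZagierPeriods.…` is the tree's mandated layout (single-conjunct summit).
set_option linter.dupNamespace false

namespace Summit.KontsevichZagierPeriods.KontsevichZagierPeriods.Cruxes.NeronTorsionSector.Translation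

/-- Gauss sum over a shifted interval: `2 ∑_{j ∈ [a, a+r)} (j − a) = r (r − 1)` in `ℤ`. -/
theorem two_mul_sum_Ico_sub_natCast (a r : ℕ) :
    2 * ∑ j ∈ Finset.Ico a (a + r), ((j : ℤ) - (a : ℤ)) = (r : ℤ) * ((r : ℤ) - 1) := by
  induction r with
  | zero => simp
  | succ k ih =>
    rw [← add_assoc, Finset.sum_Ico_succ_top (Nat.le_add_right a k), mul_add, ih]
    push_cast
    ring

/-- Gauss sum over a shifted interval: `2 ∑_{j ∈ [a, a+r)} j = r (2a + r − 1)` in `ℤ`. -/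
theorem two_mul_sum_Ico_natCast (a r : ℕ) :
    2 * ∑ j ∈ Finset.Ico a (a + r), (j : ℤ) = (r : ℤ) * (2 * (a : ℤ) + (r : ℤ) - 1) := by
  induction r with
  | zero => simp
  | succ k ih =>
    rw [← add_assoc, Finset.sum_Ico_succ_top (Nat.le_add_right a k), mul_add, ih]
    push_cast
    ring

/-- **Block U1 (`stub_bookkeeping`; pure algebra) — the integer elimination of the translation chain.**
In an abelian group `V` (the quotient `FormalRep ⧸ relations`) with "constant reps" `Lc : K →+ V` (K = real
algebraic numbers): rows `t j` (diagonal half-cells), cells `c j`, third-kind remainders `θ j`, cumulative logs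
`Λ j`, cocycle values `qq k`, subject to the move-derived recursions `t (j+1) = t j + Lc (qq (j+1)) − θ j`
(`j < n`, full loop `t n = t 0`), `c (j+1) = c j + Lc (qq (j+1) − qq j)`, the reflection `c 0 = t 0 + t (n−1)`,
`θ j = θ 0 + Λ j`, and the vanishing `hC` of the period coefficient (= `stub_periodSymmetry`): the target
combination `−q²(Σ_{j∈[aa,m)} t j + Σ (j−aa)•c j) + 2p²m Σ_{j<m} c j` equals the explicit `ℤ`-combination of the
`Λ`'s. Elimination: `2•t 0` through the reflection (coefficient `−q²(m−aa) = −2pqm` is even), `c 0` cancels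
exactly (`−pqm − pqm(r−1) + pqm·r = 0`), `n•θ 0` through the loop (coefficient `−p²m·n`).
[cite: KontsevichZagier2001, §1.2] -/
theorem stub_bookkeeping {V K : Type*} [AddCommGroup V] [AddCommGroup K]
    (n m aa : ℕ) (p q : ℤ) (hn : n = 2 * m) (haa : aa < m)
    (hpq : q * ((m : ℤ) - (aa : ℤ)) = 2 * p * (m : ℤ))
    (t c θ Λ : ℕ → V) (Lc : K →+ V) (qq : ℕ → K)
    (ht : ∀ j, j < n → t (j + 1) = t j + Lc (qq (j + 1)) - θ j)
    (hc : ∀ j, j + 1 < m → c (j + 1) = c j + Lc (qq (j + 1) - qq j))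
    (hw : t n = t 0) (hrefl : c 0 = t 0 + t (n - 1))
    (hΛ : ∀ j, j < n → θ j = θ 0 + Λ j)
    (hC : -(q ^ 2) • ∑ j ∈ Finset.Ico aa m, ∑ i ∈ Finset.range j, qq (i + 1)
        - (q ^ 2) • ∑ j ∈ Finset.Ico aa m, ((j : ℤ) - (aa : ℤ)) • (qq j - qq 0)
        + (2 * p ^ 2 * (m : ℤ)) • ∑ j ∈ Finset.range m, (qq j - qq 0)
        + (p * q * (m : ℤ)) • ∑ i ∈ Finset.range (n - 1), qq (i + 1)
        - (p ^ 2 * (m : ℤ)) • ∑ i ∈ Finset.range n, qq (i + 1) = 0) :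
    -(q ^ 2) • (∑ j ∈ Finset.Ico aa m, t j + ∑ j ∈ Finset.Ico aa m, ((j : ℤ) - (aa : ℤ)) • c j)
        + (2 * p ^ 2 * (m : ℤ)) • ∑ j ∈ Finset.range m, c j
      = (q ^ 2) • ∑ j ∈ Finset.Ico aa m, ∑ i ∈ Finset.range j, Λ i
        - (p * q * (m : ℤ)) • ∑ j ∈ Finset.range (n - 1), Λ j
        + (p ^ 2 * (m : ℤ)) • ∑ j ∈ Finset.range n, Λ j := by
  /- (1) closed form of the rows: `t j = t 0 + Lc (Σ_{i<j} qq (i+1)) − j•θ 0 − Σ_{i<j} Λ i` (`j ≤ n`) -/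
  have hT : ∀ j, j ≤ n → t j = t 0 + Lc (∑ i ∈ Finset.range j, qq (i + 1)) - (j : ℤ) • θ 0
      - ∑ i ∈ Finset.range j, Λ i := by
    intro j
    induction j with
    | zero => intro; simp
    | succ k ih =>
      intro hk
      have hk' : k < n := hk
      rw [ht k hk', ih hk'.le, hΛ k hk', Finset.sum_range_succ, Finset.sum_range_succ, map_add]
      push_cast
      rw [add_smul, one_smul]
      abel
  /- (4) closed form of the cells: `c j = c 0 + Lc (qq j − qq 0)` (`j < m`) -/
  have hCc : ∀ j, j < m → c j = c 0 + Lc (qq j - qq 0) := by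
    intro j
    induction j with
    | zero => intro; simp
    | succ k ih =>
      intro hk
      rw [hc k hk, ih (by omega), add_assoc, ← map_add]
      congr 2
      abel
  /- casts of `n` and `n − 1` -/
  have hnz : (n : ℤ) = 2 * (m : ℤ) := by omega
  have hn1 : ((n - 1 : ℕ) : ℤ) = 2 * (m : ℤ) - 1 := by omega
  /- (2) the loop: `n • θ 0 = Lc (Σ_{i<n} qq (i+1)) − Σ_{i<n} Λ i` (in the form `t 0 = t 0 + …`) -/
  have E1 := hT n le_rfl
  rw [hw, hnz] at E1
  /- (3) the reflection: `c 0 = t 0 + (t 0 + Lc (Σ_{i<n−1} qq (i+1)) − (n−1)•θ 0 − Σ_{i<n−1} Λ i)` -/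
  have E2 := hrefl
  rw [hT (n - 1) (Nat.sub_le n 1), hn1] at E2
  /- (5) the three sums of the goal in closed form -/
  have St : ∑ j ∈ Finset.Ico aa m, t j
      = ((m : ℤ) - (aa : ℤ)) • t 0 + Lc (∑ j ∈ Finset.Ico aa m, ∑ i ∈ Finset.range j, qq (i + 1))
        - (∑ j ∈ Finset.Ico aa m, (j : ℤ)) • θ 0
        - ∑ j ∈ Finset.Ico aa m, ∑ i ∈ Finset.range j, Λ i := by
    rw [Finset.sum_congr rfl fun j hj => hT j (by have := (Finset.mem_Ico.mp hj).2; omega)]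
    rw [Finset.sum_sub_distrib, Finset.sum_sub_distrib, Finset.sum_add_distrib, Finset.sum_const,
      Nat.card_Ico, map_sum, Finset.sum_smul, ← Nat.cast_sub haa.le, natCast_zsmul]
  have Sc1 : ∑ j ∈ Finset.Ico aa m, ((j : ℤ) - (aa : ℤ)) • c j
      = (∑ j ∈ Finset.Ico aa m, ((j : ℤ) - (aa : ℤ))) • c 0
        + Lc (∑ j ∈ Finset.Ico aa m, ((j : ℤ) - (aa : ℤ)) • (qq j - qq 0)) := by
    rw [Finset.sum_congr rfl fun j hj => by rw [hCc j (Finset.mem_Ico.mp hj).2]]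
    simp only [smul_add, Finset.sum_add_distrib, Finset.sum_smul, map_sum, map_zsmul]
  have Sc2 : ∑ j ∈ Finset.range m, c j
      = (m : ℤ) • c 0 + Lc (∑ j ∈ Finset.range m, (qq j - qq 0)) := by
    rw [Finset.sum_congr rfl fun j hj => hCc j (Finset.mem_range.mp hj)]
    rw [Finset.sum_add_distrib, Finset.sum_const, Finset.card_range, map_sum, natCast_zsmul]
  /- the period coefficient, pushed through `Lc` -/
  have LhC := congrArg Lc hC
  simp only [map_add, map_sub, map_zsmul, map_zero] at LhC
  /- (6) the scalar identities (`r := m − aa`, `q r = 2 p m`) -/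
  obtain ⟨r, hr⟩ := Nat.exists_eq_add_of_le haa.le
  have hσ₂ : 2 * ∑ j ∈ Finset.Ico aa m, ((j : ℤ) - (aa : ℤ)) = (r : ℤ) * ((r : ℤ) - 1) := by
    rw [hr]; exact two_mul_sum_Ico_sub_natCast aa r
  have hσ₁ : 2 * ∑ j ∈ Finset.Ico aa m, (j : ℤ) = (r : ℤ) * (2 * (aa : ℤ) + (r : ℤ) - 1) := by
    rw [hr]; exact two_mul_sum_Ico_natCast aa r
  have hrz : (r : ℤ) = (m : ℤ) - (aa : ℤ) := by omega
  rw [hrz] at hσ₁ hσ₂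
  have S1 : q ^ 2 * ∑ j ∈ Finset.Ico aa m, (j : ℤ) = p * q * (m : ℤ) * ((aa : ℤ) + (m : ℤ) - 1) :=
    mul_left_cancel₀ (two_ne_zero' ℤ) (by linear_combination q ^ 2 * hσ₁ + q * ((aa : ℤ) + m - 1) * hpq)
  have S2 : q ^ 2 * ∑ j ∈ Finset.Ico aa m, ((j : ℤ) - (aa : ℤ))
      = p * q * (m : ℤ) * ((m : ℤ) - (aa : ℤ) - 1) :=
    mul_left_cancel₀ (two_ne_zero' ℤ) (by linear_combination q ^ 2 * hσ₂ + q * ((m : ℤ) - aa - 1) * hpq)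
  /- (7) conclude -/
  rw [St, Sc1, Sc2]
  linear_combination (norm := module) LhC + (p * q * (m : ℤ)) • E2 - (p ^ 2 * (m : ℤ)) • E1
    + hpq • ((-q) • t 0) + S1 • θ 0 + hpq • ((-p * (m : ℤ)) • θ 0) - S2 • c 0
    + hpq • ((-p * (m : ℤ)) • c 0)

end Summit.KontsevichZagierPeriods.KontsevichZagierPeriods.Cruxes.NeronTorsionSector.Translation
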